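import Summits.KontsevichZagierPeriods.KontsevichZagierPeriods.Theorems.MzvKernelInKZ.Negative.Engine

/-!
# `MzvKernelInKZ` (stmt-KontsevichZagierPeriods-3914): negative side — values, and the rungs of weights 2 and 3 (unconditional)

Companion of `Negative/Engine.lean`.  Values of the word representations of weight `≤ 4`
(Kontsevich's formula `KZ.mzvRep_value_holds` and the tree's evaluations), and the two lowest
rungs: **`WeightKernelAdm 2` holds** (one admissible word, `ζ(2) ≠ 0`) and **`WeightKernelAdm 3`
holds unconditionally** — it is equivalent to the single typed membership `cDual3 ∈ relations`
(`ζ(2,1) = ζ(3)`), which is one duality move (`Negative/Duality.lean`).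

Sources: M. Kontsevich, D. Zagier, *Periods* (2001), §1.1; D. Zagier (1994), §9 (duality,
`ζ(2,1) = ζ(3)`). -/

noncomputable section

namespace Summit.KontsevichZagierPeriods.MzvKernelInKZ.Negative

open Set MeasureTheory MvPolynomial
open Literature.NumberTheory.Transcendental
open Summit.KontsevichZagierPeriods.KontsevichZagierPeriods.Theses.LinRedNormalForm (MzvKernelInKZ)

section Values

/-- Bridge to the tree: the canonical word representation of the binary word of an admissible
index `s` has value `ζ(s)` (`KZ.mzvRep_value_holds`). [folklore] -/
theorem value_wordRep_eq_multipleZeta (s : List ℕ) (hs : MZV.IsAdmissible s)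
    (ε : Fin (MZV.weight s) → Bool) (hε : Adm ε)
    (hw : ∀ i : Fin (MZV.weight s), ε i = (MZV.binaryWord s).getD i false) :
    (wordRep ε 1 hε).value = multipleZeta s := by
  rw [← KZ.mzvRep_value_holds s hs (KZ.mzvIntegrand_isSemialgebraicFunOn_holds s)
    (KZ.mzvIntegrand_integrableOn_holds s hs)]
  change ∫ t in simplex (MZV.weight s), wordFun ε 1 t =
    ∫ t in KZ.openOrderedSimplex (MZV.weight s), KZ.mzvIntegrand s t
  refine integral_congr_ae (Filter.Eventually.of_forall fun t => ?_)
  rw [wordFun_one_eq_prod_mzvForm]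
  exact Finset.prod_congr rfl fun i _ => by rw [hw i]

/-- The seven admissible words of weight `≤ 4` (letters listed from the largest variable). [folklore] -/
def ω2 : Fin 2 → Bool := ![false, true]
/-- The word `001` of `ζ(3)`. [folklore] -/
def ω3 : Fin 3 → Bool := ![false, false, true]
/-- The word `011` of `ζ(2,1)`. [folklore] -/
def ω21 : Fin 3 → Bool := ![false, true, true]
/-- The word `0001` of `ζ(4)`. [folklore] -/
def ω4 : Fin 4 → Bool := ![false, false, false, true]
/-- The word `0011` of `ζ(3,1)`. [folklore] -/
def ω31 : Fin 4 → Bool := ![false, false, true, true]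
/-- The word `0101` of `ζ(2,2)`. [folklore] -/
def ω22 : Fin 4 → Bool := ![false, true, false, true]
/-- The word `0111` of `ζ(2,1,1)`. [folklore] -/
def ω211 : Fin 4 → Bool := ![false, true, true, true]

/-- `01` is admissible. [folklore] -/
theorem adm_ω2 : Adm ω2 := by decide
/-- `001` is admissible. [folklore] -/
theorem adm_ω3 : Adm ω3 := by decide
/-- `011` is admissible. [folklore] -/
theorem adm_ω21 : Adm ω21 := by decide
/-- `0001` is admissible. [folklore] -/
theorem adm_ω4 : Adm ω4 := by decide
/-- `0011` is admissible. [folklore] -/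
theorem adm_ω31 : Adm ω31 := by decide
/-- `0101` is admissible. [folklore] -/
theorem adm_ω22 : Adm ω22 := by decide
/-- `0111` is admissible. [folklore] -/
theorem adm_ω211 : Adm ω211 := by decide

/-- `value [Δ₂, ω₀₁] = ζ(2) = π²/6` (Kontsevich's formula and Euler). [folklore] -/
theorem value_ω2 : (wordRep ω2 1 adm_ω2).value = Real.pi ^ 2 / 6 := by
  rw [← multipleZeta_two]
  exact value_wordRep_eq_multipleZeta [2] (by decide) ω2 adm_ω2 (by decide)

/-- `value [Δ₃, ω₀₀₁] = ζ(3)` (Kontsevich's formula). [folklore] -/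
theorem value_ω3 : (wordRep ω3 1 adm_ω3).value = multipleZeta [3] :=
  value_wordRep_eq_multipleZeta [3] (by decide) ω3 adm_ω3 (by decide)

/-- `value [Δ₃, ω₀₁₁] = ζ(2,1) = ζ(3)` (Kontsevich's formula and Euler's `ζ(2,1) = ζ(3)`). [folklore] -/
theorem value_ω21 : (wordRep ω21 1 adm_ω21).value = multipleZeta [3] := by
  rw [← euler_zeta_two_one_holds]
  exact value_wordRep_eq_multipleZeta [2, 1] (by decide) ω21 adm_ω21 (by decide)

/-- `value [Δ₄, ω₀₀₀₁] = ζ(4) = π⁴/90`. [folklore] -/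
theorem value_ω4 : (wordRep ω4 1 adm_ω4).value = Real.pi ^ 4 / 90 := by
  rw [← multipleZeta_four]
  exact value_wordRep_eq_multipleZeta [4] (by decide) ω4 adm_ω4 (by decide)

/-- `value [Δ₄, ω₀₀₁₁] = ζ(3,1) = π⁴/360`. [folklore] -/
theorem value_ω31 : (wordRep ω31 1 adm_ω31).value = Real.pi ^ 4 / 360 := by
  rw [← multipleZeta_three_one]
  exact value_wordRep_eq_multipleZeta [3, 1] (by decide) ω31 adm_ω31 (by decide)

/-- `value [Δ₄, ω₀₁₀₁] = ζ(2,2) = π⁴/120`. [folklore] -/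
theorem value_ω22 : (wordRep ω22 1 adm_ω22).value = Real.pi ^ 4 / 120 := by
  rw [← multipleZeta_two_two]
  exact value_wordRep_eq_multipleZeta [2, 2] (by decide) ω22 adm_ω22 (by decide)

/-- `value [Δ₄, ω₀₁₁₁] = ζ(2,1,1) = π⁴/90`. [folklore] -/
theorem value_ω211 : (wordRep ω211 1 adm_ω211).value = Real.pi ^ 4 / 90 := by
  rw [← multipleZeta_two_one_one]
  exact value_wordRep_eq_multipleZeta [2, 1, 1] (by decide) ω211 adm_ω211 (by decide)

/-- `ζ(2) ≠ 0`. [folklore] -/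
theorem value_ω2_ne_zero : (wordRep ω2 1 adm_ω2).value ≠ 0 := by
  rw [value_ω2]; positivity

/-- `ζ(3) ≠ 0` (MZVs of admissible indices are positive). [folklore] -/
theorem value_ω3_ne_zero : (wordRep ω3 1 adm_ω3).value ≠ 0 := by
  rw [value_ω3]
  exact (multipleZeta_pos_of_isAdmissible_holds (s := [3]) (by decide)).ne'

/-- `ζ(4) ≠ 0`. [folklore] -/
theorem value_ω4_ne_zero : (wordRep ω4 1 adm_ω4).value ≠ 0 := by
  rw [value_ω4]; positivity

end Values

/-! ### Weight 2: unconditional -/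

/-- The only admissible word of weight `2` is `01`. [folklore] -/
theorem adm_two_eq {ε : Fin 2 → Bool} (hε : Adm ε) : ε = ω2 := by
  obtain ⟨h0, h1⟩ := hε (by decide)
  funext i
  fin_cases i
  · simpa [ω2] using h0
  · simpa [ω2] using h1

/-- **The weight-2 rung holds**: one admissible word, `ζ(2) ≠ 0`, bookkeeping. [folklore] -/
theorem weightKernelAdm_two : WeightKernelAdm 2 := by
  refine weightKernelAdm_of_rankOne ω2 adm_ω2 value_ω2_ne_zero (fun _ => 1) fun ε hε => ?_
  obtain rfl := adm_two_eq hε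
  simp

/-! ### Weight 3: one typed membership, which is one duality move -/

/-- TYPED TARGET, weight 3: duality `[Δ₃, ω₀₁₁] − [Δ₃, ω₀₀₁]` (value `ζ(2,1) − ζ(3) = 0`);
ONE change-of-variables move `tᵢ ↦ 1 − t_{2−i}` (`cDual3_mem_relations` below). [folklore] -/
def cDual3 : KZ.FormalRep := KZ.of (wordRep ω21 1 adm_ω21) - KZ.of (wordRep ω3 1 adm_ω3)

/-- `cDual3` lies in the admissible weight-3 closure. [folklore] -/
theorem cDual3_mem_closure : cDual3 ∈ AddSubgroup.closure (genSetAdm 3) :=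
  sub_mem (AddSubgroup.subset_closure (of_wordRep_mem_genSetAdm _ _ _))
    (AddSubgroup.subset_closure (of_wordRep_mem_genSetAdm _ _ _))

/-- `cDual3` evaluates to `ζ(2,1) − ζ(3) = 0`. [folklore] -/
theorem eval_cDual3 : KZ.eval cDual3 = 0 := by
  rw [cDual3, map_sub, KZ.eval_of, KZ.eval_of, value_ω21, value_ω3, sub_self]

/-- The admissible words of weight `3` are `001` and `011`. [folklore] -/
theorem adm_three_cases {ε : Fin 3 → Bool} (hε : Adm ε) : ε = ω3 ∨ ε = ω21 := by
  obtain ⟨h0, h2⟩ := hε (by decide)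
  cases h1 : ε 1
  · left
    funext i
    fin_cases i
    · simpa [ω3] using h0
    · simpa [ω3] using h1
    · simpa [ω3] using h2
  · right
    funext i
    fin_cases i
    · simpa [ω21] using h0
    · simpa [ω21] using h1
    · simpa [ω21] using h2

/-- **Weight 3 ⟺ duality is a relation.** [folklore] -/
theorem weightKernelAdm_three_iff : WeightKernelAdm 3 ↔ cDual3 ∈ KZ.relations := by
  constructor
  · intro h
    exact h _ cDual3_mem_closure eval_cDual3
  · intro hD
    refine weightKernelAdm_of_rankOne ω3 adm_ω3 value_ω3_ne_zero (fun _ => 1) fun ε hε => ?_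
    rcases adm_three_cases hε with rfl | rfl
    · simp
    · exact hD
/-- `(001)† = 011`. [folklore] -/
theorem dualWord_ω3 : dualWord ω3 = ω21 := by decide

/-- `ζ(2,1) = ζ(3)` inside the calculus: `cDual3` is (minus) one move. [folklore] -/
theorem cDual3_mem_relations : cDual3 ∈ KZ.relations := by
  have h := duality_mem_relations ω3 1 adm_ω3
  rw [wordRep_congr dualWord_ω3 1 (adm_dualWord adm_ω3) adm_ω21] at h
  simpa [cDual3] using KZ.relations.neg_mem h

/-- **THE WEIGHT-3 RUNG OF THE CRUX HOLDS, unconditionally** (duality move + bookkeeping +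
`ζ(3) > 0`). Picture by weight: `w = 2` trivial, `w = 3` proved, `w = 4` ⟺ two move-chain
problems, `w ≥ 5` meets an open independence statement (engine hypothesis `hind`). [folklore] -/
theorem weightKernelAdm_three : WeightKernelAdm 3 :=
  weightKernelAdm_three_iff.mpr cDual3_mem_relations

end Summit.KontsevichZagierPeriods.MzvKernelInKZ.Negative
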